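import Summits.ResolutionOfSingularities.ResolutionOfSingularities.Theorems.MarkedTransferCampaignW46ExitTreeBranching
import HarnessLib

/-!
# König's argument for the marked quadratic tree: finite unless it has an infinite branch

[OURS · L1 W4.6 rung (i-a)′, INVARIANT layer — cell res-hironaka, LADDER-RESOLUTION rung L, D-0089; campaign s46,
seat res-D-pv-044 AS res-L1-s46-pv-8; host route MarkedTransfer, `--supports stmt-ResolutionOfSingularities-16156
--as helper`.] HONEST FRAMING: nothing here is a statement of H. Hironaka's manuscript (2017-03-23, [Hironaka2017]);
pure commutative algebra inside a field `K`, continuing `MarkedTransferCampaignW46ExitTree{,Branching}.lean`.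
AI-written; weaker than expert review. No `sorry`; axioms standard.

The marked quadratic tree above a node is finitely branching (`finite_setOf_markedStep_isSingularNode`,
`…ExitTreeBranching.lean`), so by KÖNIG's lemma it is finite as soon as it has no infinite branch — no infinite
sequence `n₀ → n₁ → n₂ → ⋯` of marked steps (an infinite chain `R = S₀ < S₁ < ⋯` of two-dimensional quadratic
transforms along which the controlled transforms of `(J, b)` keep order in `[b, 2b)`). The infinite-branch
contradiction itself (Zariski's principalization along the chain, then the monomial phase) is the valuative core of
rung (i-a) (res-L1-s46-pv-1) and is NOT proved here; this file is the reduction (pattern = the tree's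
`finite_idealBaseTree_of_isRegularLocalRing`, `BaseTreeFiniteKonig.lean`). PROVED:

* `exitTree_subset_insert_biUnion` — the tree above `n` is `{n}` plus the trees above its singular children;
* `exists_markedStep_infinite` — KÖNIG STEP: an infinite tree has a child with infinite tree;
* `finite_exitTree_of_no_infinite_branch` — **no infinite sequence of marked steps out of `n₀` ⇒ the tree above
  `n₀` is finite**;
* `sum_exitCount_lt_of_no_infinite_branch` — Zariski's count at a tame node under the same hypothesis (the centre
  inequality of rung (i-a)′ in the currency of res-L1-s46-pv-9's dictionary).

## References

* O. Zariski, P. Samuel, *Commutative Algebra* II (1960), Appendix 5. [ZariskiSamuel1960]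
* D. Kőnig, *Über eine Schlussweise aus dem Endlichen ins Unendliche*, Acta Sci. Math. (Szeged) 3 (1927) 121–130.
-/

noncomputable section

open IsLocalRing

-- single-problem summit: the doubled namespace component `ResolutionOfSingularities` is forced
set_option linter.dupNamespace false

namespace Summit.ResolutionOfSingularities.ResolutionOfSingularities.Theorems.CampaignW46

open Literature.AlgebraicGeometry.Resolution

universe u

variable {K : Type u} [Field K] {b : ℕ}

/-- The tree above `n` decomposes into `{n}` and the trees above the singular children of `n`. [folklore] -/
theorem exitTree_subset_insert_biUnion (n : MarkedNode K) :
    exitTree b n ⊆ insert n (⋃ n₁ ∈ {n₁ : MarkedNode K | MarkedStep b n n₁ ∧ IsSingularNode b n₁},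
      exitTree b n₁) := by
  intro m hm
  rcases mem_exitTree_cases hm with rfl | ⟨n₁, h₁, hm₁⟩
  · exact Set.mem_insert _ _
  · refine Set.mem_insert_of_mem _ (Set.mem_iUnion₂.mpr ⟨n₁, ⟨h₁, ?_⟩, hm₁⟩)
    -- `n₁` is singular: it is `m` itself, or the (tame) source of a further step
    rcases mem_exitTree_cases hm₁ with rfl | ⟨n₂, h₂, -⟩
    · exact hm₁.2
    · exact h₂.isTameNode.isSingularNode

/-- **König step**: if the tree above `n` is infinite then so is the tree above one of the (finitely many)
singular children of `n`. [folklore] -/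
theorem exists_markedStep_infinite {n : MarkedNode K} (hinf : (exitTree b n).Infinite) :
    ∃ n₁, MarkedStep b n n₁ ∧ (exitTree b n₁).Infinite := by
  by_contra hall
  push Not at hall
  apply hinf
  refine (((finite_setOf_markedStep_isSingularNode b n).biUnion' fun n₁ hn₁ => ?_).insert n).subset
    (exitTree_subset_insert_biUnion n)
  exact hall n₁ hn₁.1

/-- **König's lemma for the marked quadratic tree**: if there is no infinite sequence of marked steps out of `n₀`
(no infinite chain of two-dimensional quadratic transforms along which the controlled transforms of `(J, b)` keep
order in `[b, 2b)`), then the tree above `n₀` is finite. [cite: ZariskiSamuel1960, Appendix 5] -/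
theorem finite_exitTree_of_no_infinite_branch (n₀ : MarkedNode K)
    (hno : ∀ c : ℕ → MarkedNode K, c 0 = n₀ → (∀ i, MarkedStep b (c i) (c (i + 1))) → False) :
    (exitTree b n₀).Finite := by
  classical
  by_contra hinf
  rw [Set.not_finite] at hinf
  let P : MarkedNode K → Prop := fun n => (exitTree b n).Infinite
  have step : ∀ n, P n → ∃ n₁, P n₁ ∧ MarkedStep b n n₁ := fun n hn => by
    obtain ⟨n₁, h₁, hinf₁⟩ := exists_markedStep_infinite hn
    exact ⟨n₁, hinf₁, h₁⟩
  choose next hnextP hnextStep using step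
  -- the infinite branch
  let seq : ℕ → {n : MarkedNode K // P n} :=
    fun i => Nat.rec ⟨n₀, hinf⟩ (fun _ n => ⟨next n.1 n.2, hnextP n.1 n.2⟩) i
  exact hno (fun i => (seq i).1) rfl fun i => hnextStep (seq i).1 (seq i).2

/-- **The centre inequality of rung (i-a)′, modulo the infinite-branch contradiction.** At a tame node
`⟨S, J⟩` out of which no infinite sequence of marked steps exists, for every finite set `F` of distinct
two-dimensional first quadratic transforms `S'` of `S`:
`∑_{S' ∈ F} ν(S', (J S' : (𝔪_S S')^b), b) < ν(S, J, b)`. [cite: ZariskiSamuel1960, Appendix 5] -/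
theorem sum_exitCount_lt_of_no_infinite_branch {S : Subring K} [IsRegularLocalRing S] {J : Ideal S}
    (hS : IsTameNode b (⟨S, J⟩ : MarkedNode K))
    (hno : ∀ c : ℕ → MarkedNode K, c 0 = (⟨S, J⟩ : MarkedNode K) →
      (∀ i, MarkedStep b (c i) (c (i + 1))) → False)
    (F : Finset (Subring K)) (hF : ∀ S' ∈ F, IsQuadraticTransform S S' ∧ ringKrullDim S' = 2) :
    ∑ S' ∈ F, exitCount b S' (ctrlTransform b S J S') < exitCount b S J :=
  sum_exitCount_lt hS (finite_exitTree_of_no_infinite_branch _ hno) F hF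

end Summit.ResolutionOfSingularities.ResolutionOfSingularities.Theorems.CampaignW46

end
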